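import Literature.NumberTheory.EllipticCurves.TwoIsogenyDualKernel
import Literature.NumberTheory.EllipticCurves.ShaIsogenyProofs
import Literature.NumberTheory.EllipticCurves.TwoIsogenySelmerGroupSha
import Literature.NumberTheory.EllipticCurves.ZpCorankQuasiIso
import HarnessLib

/-!
# `Ш(E)[φ] = 0` and `Ш(E')[φ̂] = 0` imply `Ш(E)[2] = 0` and `Ш(E')[2] = 0`
# (descent via `2`-isogeny: Silverman, *AEC*, X.4.2(a) with III.6.1, `φ̂ ∘ φ = [2]`)

Sibling proof file of `TwoIsogenyTorsorImage.lean` (`im Ξ_V = ker (φ_V)_*` on `H¹(K, V)`) and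
`TwoIsogenyDualKernel.lean` (`ker ψ_* = ker (φ_{V'})_*` for any `ψ : V' → V` with `ψ ∘ φ_V = [2]`).
For `V : y² = x³ + ax² + bx` in two-torsion normal form over a number field `K`, `φ = φ_V : V → V'`
the explicit `2`-isogeny and `φ̂ : V' → V` its dual (`Isogeny.exists_dual_of_isElliptic`,
`φ̂ ∘ φ = [2]`, hence `φ ∘ φ̂ = [2]` as `φ` is onto `V'(K̄)`), the tree expresses
`Ш(V/K)[φ] = ker Ш(φ)` as `Ш(V) ∩ im Ξ_V` and `Ш(V'/K)[φ̂] = ker Ш(φ̂) = ker Ш(φ_{V'})` as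
`Ш(V') ∩ im Ξ_{V'}` (`natCard_sha_inf_range_twoIsogenyTorsorHom_eq`, `ker_shaMap_eq_of_comp_twoIsogeny`).
This file proves the elementary consequence used in every complete `2`-descent
(e.g. Zywina 2025, §1: "we are fortunate to always have `Ш(E/ℚ)[2] = 0`", from the equalities
`im δ = Sel^{(φ)}`, `im δ' = Sel^{(φ̂)}` of his Lemma 3.3):

  **if `Ш(V)[φ] = 0` and `Ш(V')[φ̂] = 0` then `Ш(V)[2] = 0` and `Ш(V')[2] = 0`.**

Proof (functoriality only): for `c ∈ Ш(V)` with `2c = 0`, `Ш(φ̂)(Ш(φ) c) = 2c = 0`, so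
`Ш(φ) c ∈ ker Ш(φ̂) = 0`, so `c ∈ ker Ш(φ) = 0`; symmetrically for `c ∈ Ш(V')` using `φ ∘ φ̂ = [2]`.
Consequences recorded for the tree's coranks: a Tate–Shafarevich group without `p`-torsion has
trivial `p`-primary part `Ш[p^∞] = ⊥` and `corank_{ℤ_p} Ш[p^∞] = 0` (`WeierstrassCurve.shaCorank`), so
that `corank Sel_{p^∞} = rank` by the tree's proved corank identity
(`selmerCorank_eq_mordellWeilRank_add_holds`, not imported here).

* `WeierstrassCurve.exists_isogeny_comp_twoIsogeny_eq_two` — the dual `φ̂ : V' → V` with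
  `φ̂ ∘ φ = [2]` and `φ ∘ φ̂ = [2]`.
* `WeierstrassCurve.eq_zero_of_mem_sha_of_two_smul_eq_zero` — `Ш(V)[2] = 0`;
  `WeierstrassCurve.eq_zero_of_mem_sha_twoIsogenyCodomain_of_two_smul_eq_zero` — `Ш(V')[2] = 0`
  (both from `Ш(V) ∩ im Ξ_V = ⊥` and `Ш(V') ∩ im Ξ_{V'} = ⊥`); subgroup form
  `WeierstrassCurve.sha_inf_torsionBy_two_eq_bot`.
* `WeierstrassCurve.primaryComponent_sha_eq_bot_of_forall`, `WeierstrassCurve.shaCorank_eq_zero_of_forall` —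
  no `p`-torsion ⇒ (no `p`-power torsion ⇒) `Ш[p^∞] = ⊥` ⇒ `corank_{ℤ_p} Ш[p^∞] = 0` (any curve over a
  number field).
* `Literature.NumberTheory.EllipticCurves.forall_mem_sha_two_smul_eq_zero_of_halfModel` — over `ℚ`, for
  `E = E_{a,b}` (`a, b ∈ ℤ`) and the half-model `V₀` of `E'` (`V₀' = E` literally,
  `twoIsogenyCodomain_halfModel`): `Ш(V₀) ∩ im Ξ = ⊥` and `Ш(E) ∩ im Ξ = ⊥` ⇒ `Ш(E)[2] = 0` — the form
  in which complete `2`-isogeny descents are recorded in the tree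
  (`two_pow_twoIsogenySelmerRank_eq_natCard_mul_halfModel`, `two_pow_twoIsogenySelmerRank'_eq_natCard_mul`).

## References

* J. H. Silverman, *The Arithmetic of Elliptic Curves*, 2nd ed., GTM 106 (2009), Thm. III.6.1 (dual
  isogeny, `φ̂ ∘ φ = [m]`), III.6.2(a) (`φ ∘ φ̂ = [m]`), Thm. X.4.2(a) (the Kummer sequence of an isogeny,
  `WC(E/K)[φ]`), Prop. X.4.9. [SilvermanAEC2009]
* D. Zywina, *There are infinitely many elliptic curves over the rationals of rank 2*, arXiv:2502.01957
  (2025), §1 (remark `Ш(E/ℚ)[2] = 0`) and Lemma 3.3. [Zywina2025]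
* R. Greenberg, *Iwasawa theory for elliptic curves*, LNM 1716 (1999), §1 (coranks). [Greenberg1999]

## Design

Theorems only, no definitions, no named facts. Same conventions as the sibling files (`K : Type u`,
`open scoped Classical`; deliberate dot-notation extensions in `namespace WeierstrassCurve`). The
`2`-torsion hypothesis is stated elementwise (`2 • c = 0 → c = 0` for `c ∈ Ш`, `2 : ℕ`), the most
directly usable form; the subgroup form `Ш ⊓ H¹(K, E)[2] = ⊥` is derived.
-/

noncomputable section

open scoped Classical

universe u

namespace WeierstrassCurve

open Literature.NumberTheory.EllipticCurves
open _root_.WeierstrassCurve.Affine (SqUnits)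

/-! ## The dual of the explicit `2`-isogeny -/

section General

variable {K : Type u} [Field K] [NumberField K] (V : WeierstrassCurve K) [V.IsTwoTorsionNF] [V.IsElliptic]

/-- **The dual `φ̂ : V' → V` of the explicit `2`-isogeny `φ = φ_V`**: an isogeny over `K` with
`φ̂ (φ P) = 2P` on `V(K̄)` (Silverman, *AEC*, Thm. III.6.1(a), the tree's
`Isogeny.exists_dual_of_isElliptic` with `deg φ = 2`, `degree_twoIsogeny`) and `φ (φ̂ Q) = 2Q` on `V'(K̄)`
(III.6.2(a); here from the surjectivity of `φ` on `K̄`-points, `twoIsogenyGeomHom_surjective`).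
[cite: SilvermanAEC2009, Thm. III.6.1(a) and Thm. III.6.2(a)] -/
theorem exists_isogeny_comp_twoIsogeny_eq_two :
    ∃ ψ : Isogeny V.twoIsogenyCodomain V,
      (∀ P : V.geomPoints, ψ.toAddMonoidHom (V.twoIsogenyGeomHom P) = ((2 : ℕ) : ℤ) • P) ∧
        ∀ Q : V.twoIsogenyCodomain.geomPoints,
          V.twoIsogenyGeomHom (ψ.toAddMonoidHom Q) = ((2 : ℕ) : ℤ) • Q := by
  obtain ⟨ψ, hψ⟩ := V.twoIsogeny.exists_dual_of_isElliptic
  have hψ2 : ∀ P : V.geomPoints, ψ.toAddMonoidHom (V.twoIsogenyGeomHom P) = ((2 : ℕ) : ℤ) • P := by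
    intro P
    have h := hψ P
    rw [degree_twoIsogeny] at h
    exact h
  refine ⟨ψ, hψ2, fun Q ↦ ?_⟩
  obtain ⟨P, rfl⟩ := V.twoIsogenyGeomHom_surjective Q
  rw [hψ2, map_zsmul]

/-! ## `Ш(V)[2] = 0` and `Ш(V')[2] = 0` -/

/-- **`Ш(V)[φ] = 0 ∧ Ш(V')[φ̂] = 0 ⇒ Ш(V)[2] = 0`.** For `V` in two-torsion normal form over a number
field with `Ш(V/K) ∩ im Ξ_V = ⊥` (`Ш(V)[φ] = 0`) and `Ш(V'/K) ∩ im Ξ_{V'} = ⊥` (`Ш(V')[φ̂] = 0`), every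
`c ∈ Ш(V/K)` with `2c = 0` vanishes: `φ̂_* (φ_* c) = 2c = 0` (`galH1Map_galH1Map_of_comp_eq_nsmul`), so
`φ_* c ∈ Ш(V') ∩ ker φ̂_* = Ш(V') ∩ ker (φ_{V'})_* = Ш(V') ∩ im Ξ_{V'} = ⊥`
(`ker_galH1Map_eq_of_comp_twoIsogeny`, `range_twoIsogenyTorsorHom_eq_ker_galH1Map`), whence
`c ∈ Ш(V) ∩ ker φ_* = Ш(V) ∩ im Ξ_V = ⊥`. Silverman, *AEC*, X.4.2(a) with III.6.1; used e.g. in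
Zywina 2025, §1 ("`Ш(E/ℚ)[2] = 0`"). [cite: SilvermanAEC2009, Thm. X.4.2(a) and Thm. III.6.1(a)] -/
theorem eq_zero_of_mem_sha_of_two_smul_eq_zero
    (hV : V.sha ⊓ AddMonoidHom.range (G := Additive (SqUnits K)) V.twoIsogenyTorsorHom = ⊥)
    (hV' : V.twoIsogenyCodomain.sha ⊓
      AddMonoidHom.range (G := Additive (SqUnits K)) V.twoIsogenyCodomain.twoIsogenyTorsorHom = ⊥)
    {c : V.galH1} (hc : c ∈ V.sha) (h2 : 2 • c = 0) : c = 0 := by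
  obtain ⟨ψ, hψφ, -⟩ := V.exists_isogeny_comp_twoIsogeny_eq_two
  -- `φ_* c ∈ Ш(V')`
  have hφc : galH1Map V.twoIsogenyGeomHom (twoIsogenyGeomHom_smul V) c ∈ V.twoIsogenyCodomain.sha :=
    galH1Map_mem_sha V.twoIsogenyGeomHom (twoIsogenyGeomHom_smul V)
      V.twoIsogeny.hasLocalPointsMaps_toAddMonoidHom hc
  -- `φ̂_* (φ_* c) = 2 • c = 0`
  have hψc : galH1Map ψ.toAddMonoidHom ψ.equivariant
      (galH1Map V.twoIsogenyGeomHom (twoIsogenyGeomHom_smul V) c) = 0 := by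
    rw [galH1Map_galH1Map_of_comp_eq_nsmul V.twoIsogenyGeomHom (twoIsogenyGeomHom_smul V)
      ψ.toAddMonoidHom ψ.equivariant hψφ c, h2]
  -- hence `φ_* c ∈ Ш(V') ∩ im Ξ_{V'} = ⊥`
  have hφc0 : galH1Map V.twoIsogenyGeomHom (twoIsogenyGeomHom_smul V) c = 0 := by
    have hmem : galH1Map V.twoIsogenyGeomHom (twoIsogenyGeomHom_smul V) c ∈
        AddMonoidHom.range (G := Additive (SqUnits K)) V.twoIsogenyCodomain.twoIsogenyTorsorHom := by
      rw [range_twoIsogenyTorsorHom_eq_ker_galH1Map,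
        ← ker_galH1Map_eq_of_comp_twoIsogeny ψ.toAddMonoidHom ψ.equivariant (fun P ↦ ?_),
        AddMonoidHom.mem_ker]
      · exact hψc
      · rw [hψφ, ← natCast_zsmul]
    exact AddSubgroup.mem_bot.mp (hV'.le (AddSubgroup.mem_inf.mpr ⟨hφc, hmem⟩))
  -- so `c ∈ Ш(V) ∩ ker φ_* = Ш(V) ∩ im Ξ_V = ⊥`
  have hmem : c ∈ AddMonoidHom.range (G := Additive (SqUnits K)) V.twoIsogenyTorsorHom := by
    rw [range_twoIsogenyTorsorHom_eq_ker_galH1Map, AddMonoidHom.mem_ker]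
    exact hφc0
  exact AddSubgroup.mem_bot.mp (hV.le (AddSubgroup.mem_inf.mpr ⟨hc, hmem⟩))

/-- **`Ш(V)[φ] = 0 ∧ Ш(V')[φ̂] = 0 ⇒ Ш(V')[2] = 0`.** Under the same two hypotheses every
`c ∈ Ш(V'/K)` with `2c = 0` vanishes: `φ_* (φ̂_* c) = 2c = 0`, so
`φ̂_* c ∈ Ш(V) ∩ ker φ_* = Ш(V) ∩ im Ξ_V = ⊥`, whence
`c ∈ Ш(V') ∩ ker φ̂_* = Ш(V') ∩ ker (φ_{V'})_* = Ш(V') ∩ im Ξ_{V'} = ⊥`.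
Silverman, *AEC*, X.4.2(a) with III.6.1–6.2. [cite: SilvermanAEC2009, Thm. X.4.2(a) and Thm. III.6.2(a)] -/
theorem eq_zero_of_mem_sha_twoIsogenyCodomain_of_two_smul_eq_zero
    (hV : V.sha ⊓ AddMonoidHom.range (G := Additive (SqUnits K)) V.twoIsogenyTorsorHom = ⊥)
    (hV' : V.twoIsogenyCodomain.sha ⊓
      AddMonoidHom.range (G := Additive (SqUnits K)) V.twoIsogenyCodomain.twoIsogenyTorsorHom = ⊥)
    {c : V.twoIsogenyCodomain.galH1} (hc : c ∈ V.twoIsogenyCodomain.sha) (h2 : 2 • c = 0) :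
    c = 0 := by
  obtain ⟨ψ, hψφ, hφψ⟩ := V.exists_isogeny_comp_twoIsogeny_eq_two
  -- `φ̂_* c ∈ Ш(V)`
  have hψc : galH1Map ψ.toAddMonoidHom ψ.equivariant c ∈ V.sha :=
    galH1Map_mem_sha ψ.toAddMonoidHom ψ.equivariant ψ.hasLocalPointsMaps_toAddMonoidHom hc
  -- `φ_* (φ̂_* c) = 2 • c = 0`
  have hφψc : galH1Map V.twoIsogenyGeomHom (twoIsogenyGeomHom_smul V)
      (galH1Map ψ.toAddMonoidHom ψ.equivariant c) = 0 := by
    rw [galH1Map_galH1Map_of_comp_eq_nsmul ψ.toAddMonoidHom ψ.equivariant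
      V.twoIsogenyGeomHom (twoIsogenyGeomHom_smul V) hφψ c, h2]
  -- hence `φ̂_* c ∈ Ш(V) ∩ im Ξ_V = ⊥`
  have hψc0 : galH1Map ψ.toAddMonoidHom ψ.equivariant c = 0 := by
    have hmem : galH1Map ψ.toAddMonoidHom ψ.equivariant c ∈
        AddMonoidHom.range (G := Additive (SqUnits K)) V.twoIsogenyTorsorHom := by
      rw [range_twoIsogenyTorsorHom_eq_ker_galH1Map, AddMonoidHom.mem_ker]
      exact hφψc
    exact AddSubgroup.mem_bot.mp (hV.le (AddSubgroup.mem_inf.mpr ⟨hψc, hmem⟩))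
  -- so `c ∈ Ш(V') ∩ ker φ̂_* = Ш(V') ∩ im Ξ_{V'} = ⊥`
  have hmem : c ∈
      AddMonoidHom.range (G := Additive (SqUnits K)) V.twoIsogenyCodomain.twoIsogenyTorsorHom := by
    rw [range_twoIsogenyTorsorHom_eq_ker_galH1Map,
      ← ker_galH1Map_eq_of_comp_twoIsogeny ψ.toAddMonoidHom ψ.equivariant (fun P ↦ ?_),
      AddMonoidHom.mem_ker]
    · exact hψc0
    · rw [hψφ, ← natCast_zsmul]
  exact AddSubgroup.mem_bot.mp (hV'.le (AddSubgroup.mem_inf.mpr ⟨hc, hmem⟩))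

/-- **`Ш(V/K)[2] = 0` and `Ш(V'/K)[2] = 0` as subgroups of `H¹(K, ·)`** (`Ш ⊓ H¹[2] = ⊥`), from
`Ш(V)[φ] = 0` and `Ш(V')[φ̂] = 0`. [cite: SilvermanAEC2009, Thm. X.4.2(a) and Thm. III.6.1(a)] -/
theorem sha_inf_torsionBy_two_eq_bot
    (hV : V.sha ⊓ AddMonoidHom.range (G := Additive (SqUnits K)) V.twoIsogenyTorsorHom = ⊥)
    (hV' : V.twoIsogenyCodomain.sha ⊓
      AddMonoidHom.range (G := Additive (SqUnits K)) V.twoIsogenyCodomain.twoIsogenyTorsorHom = ⊥) :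
    V.sha ⊓ AddSubgroup.torsionBy V.galH1 2 = ⊥ ∧
      V.twoIsogenyCodomain.sha ⊓ AddSubgroup.torsionBy V.twoIsogenyCodomain.galH1 2 = ⊥ := by
  refine ⟨eq_bot_iff.mpr fun c hc ↦ ?_, eq_bot_iff.mpr fun c hc ↦ ?_⟩
  · rw [AddSubgroup.mem_inf] at hc
    have h2 : 2 • c = 0 := (AddSubgroup.torsionBy.nsmul_iff (n := 2)).mp hc.2
    exact AddSubgroup.mem_bot.mpr (V.eq_zero_of_mem_sha_of_two_smul_eq_zero hV hV' hc.1 h2)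
  · rw [AddSubgroup.mem_inf] at hc
    have h2 : 2 • c = 0 := (AddSubgroup.torsionBy.nsmul_iff (n := 2)).mp hc.2
    exact AddSubgroup.mem_bot.mpr
      (V.eq_zero_of_mem_sha_twoIsogenyCodomain_of_two_smul_eq_zero hV hV' hc.1 h2)

end General

/-! ## No `p`-torsion in `Ш` ⇒ `Ш[p^∞] = ⊥` and `corank_{ℤ_p} Ш[p^∞] = 0` -/

section Corank

variable {K : Type u} [Field K] [NumberField K] (W : WeierstrassCurve K)

/-- A Tate–Shafarevich group without `p`-torsion has no `p`-power torsion: if `p • c = 0 ⇒ c = 0` on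
`Ш(W/K)` then `p ^ k • c = 0 ⇒ c = 0` (induction on `k`; private helper). [folklore] -/
private theorem eq_zero_of_mem_sha_of_pow_smul_eq_zero {p : ℕ} (h : ∀ c ∈ W.sha, p • c = 0 → c = 0)
    {c : W.galH1} (hc : c ∈ W.sha) {k : ℕ} (hk : p ^ k • c = 0) : c = 0 := by
  induction k generalizing c with
  | zero => simpa using hk
  | succ k ih =>
    rw [pow_succ, mul_nsmul] at hk
    exact ih hc (h _ (W.sha.nsmul_mem hc _) hk)

/-- **No `p`-torsion ⇒ `Ш(W/K)[p^∞] = ⊥`**: the `p`-primary subgroup `Ш_E(K)_p` of `Ш` (Mathlib's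
`AddCommGroup.primaryComponent`; the group whose `ℤ_p`-corank is the tree's `WeierstrassCurve.shaCorank`,
Greenberg (1999), §1) is trivial as soon as `Ш[p] = 0` — a nonzero `p`-primary group has an element of
order `p`. [cite: Greenberg1999, §1] -/
theorem primaryComponent_sha_eq_bot_of_forall {p : ℕ} (h : ∀ c ∈ W.sha, p • c = 0 → c = 0) :
    AddCommGroup.primaryComponent W.sha p = ⊥ := by
  rw [eq_bot_iff]
  intro x hx
  obtain ⟨k, hk⟩ := (AddCommGroup.mem_primaryComponent).mp hx
  have hk' : p ^ k • (x : W.galH1) = 0 := by exact_mod_cast congrArg Subtype.val hk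
  exact AddSubgroup.mem_bot.mpr (Subtype.ext (W.eq_zero_of_mem_sha_of_pow_smul_eq_zero h x.2 hk'))

/-- **No `p`-torsion ⇒ `corank_{ℤ_p} Ш(W/K)[p^∞] = 0`** (`Ш[p^∞] = ⊥` is finite, and a finite group has
corank `0`, tree `zpCorank_of_finite_eq_zero`). Greenberg (1999), §1. [cite: Greenberg1999, §1] -/
theorem shaCorank_eq_zero_of_forall (p : ℕ) [Fact p.Prime] (h : ∀ c ∈ W.sha, p • c = 0 → c = 0) :
    W.shaCorank p = 0 := by
  have hbot := W.primaryComponent_sha_eq_bot_of_forall h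
  haveI : Finite (AddCommGroup.primaryComponent W.sha p) := by
    rw [hbot]
    infer_instance
  exact zpCorank_of_finite_eq_zero p

/-- Transport of "`Ш` has no `2`-torsion" along an equality of curves (private helper). [folklore] -/
private theorem forall_mem_sha_two_smul_eq_zero_congr {X Y : WeierstrassCurve K} (h : X = Y) :
    (∀ c ∈ X.sha, 2 • c = 0 → c = 0) ↔ ∀ c ∈ Y.sha, 2 • c = 0 → c = 0 := by
  subst h
  exact Iff.rfl

end Corank

end WeierstrassCurve

/-! ## Over `ℚ`: the half-model bookkeeping of the tree's Selmer counts -/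

namespace Literature.NumberTheory.EllipticCurves

open _root_.WeierstrassCurve

/-- **`Ш(E')[φ̂] = 0 ∧ Ш(E)[φ] = 0 ⇒ Ш(E/ℚ)[2] = 0` for `E = E_{a,b} : y² = x³ + ax² + bx`**
(`a, b ∈ ℤ`), in the form in which the tree records complete `2`-isogeny descents: with
`V₀ : y² = x³ - (a/2)x² + ((a² - 4b)/16)x` the model of `E'` whose `2`-isogenous curve is `E` literally
(`twoIsogenyCodomain_halfModel`; the factor `#(Ш(V₀) ∩ im Ξ)` of
`two_pow_twoIsogenySelmerRank_eq_natCard_mul_halfModel` is `#Ш(E')[φ̂]`, the factor `#(Ш(E) ∩ im Ξ)` of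
`two_pow_twoIsogenySelmerRank'_eq_natCard_mul` is `#Ш(E)[φ]`), the vanishing of both factors forces
`Ш(E/ℚ)[2] = 0`. [cite: SilvermanAEC2009, Thm. X.4.2(a) and Thm. III.6.2(a)] -/
theorem forall_mem_sha_two_smul_eq_zero_of_halfModel {a b : ℤ}
    [hV₀ : (⟨0, -(a : ℚ) / 2, 0, ((a : ℚ) ^ 2 - 4 * b) / 16, 0⟩ : WeierstrassCurve ℚ).IsElliptic]
    [hE : (⟨0, (a : ℚ), 0, (b : ℚ), 0⟩ : WeierstrassCurve ℚ).IsElliptic]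
    (h₀ : (⟨0, -(a : ℚ) / 2, 0, ((a : ℚ) ^ 2 - 4 * b) / 16, 0⟩ : WeierstrassCurve ℚ).sha ⊓
      (⟨0, -(a : ℚ) / 2, 0, ((a : ℚ) ^ 2 - 4 * b) / 16, 0⟩ :
        WeierstrassCurve ℚ).twoIsogenyTorsorHom.range = ⊥)
    (h₁ : (⟨0, (a : ℚ), 0, (b : ℚ), 0⟩ : WeierstrassCurve ℚ).sha ⊓
      (⟨0, (a : ℚ), 0, (b : ℚ), 0⟩ : WeierstrassCurve ℚ).twoIsogenyTorsorHom.range = ⊥) :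
    ∀ c ∈ (⟨0, (a : ℚ), 0, (b : ℚ), 0⟩ : WeierstrassCurve ℚ).sha, 2 • c = 0 → c = 0 := by
  have hE' := twoIsogenyCodomain_halfModel a b
  -- transport of the `Ξ`-hypothesis along `V₀' = E` (the instances are propositions)
  have transfer : ∀ {W₁ W₂ : WeierstrassCurve ℚ} (_ : W₁ = W₂) [W₁.IsTwoTorsionNF] [W₁.IsElliptic]
      [W₂.IsTwoTorsionNF] [W₂.IsElliptic],
      W₂.sha ⊓ W₂.twoIsogenyTorsorHom.range = ⊥ → W₁.sha ⊓ W₁.twoIsogenyTorsorHom.range = ⊥ := by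
    intro W₁ W₂ h _ _ _ _ h₂
    subst h
    exact h₂
  rw [← forall_mem_sha_two_smul_eq_zero_congr hE']
  exact fun c hc h2 ↦ eq_zero_of_mem_sha_twoIsogenyCodomain_of_two_smul_eq_zero _ h₀ (transfer hE' h₁) hc h2

end Literature.NumberTheory.EllipticCurves

end
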